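/-
Copyright (c) 2026 the pub-hodgecm-mathlib formalisation cell (harness21).  Prover seat hodgecm-mathlib-K2E3-p03 (g4), Track B «K2-LIT» ∕ h413
(`stmt-HodgeConjecture-24833`), line `K2_E3_EllipticInputs`, unit U12, §L leaf (LBGL-ge3) at `N = 3` (Richardson road), brick R′ of the (F-E) road memo
`K2/K2E3-p11/g4/MEMO-FE-ParabolicSliceDensity.v1.K2E3-p11-g4.md` §2 (shared with the (F-J) census of K2E3-p17 (g6), §1 (vi)) — PART 2: THE NUMBER OF
`F`-RATIONAL ROOTS OF THE CHARACTERISTIC POLYNOMIAL OF A `3 × 3` MATRIX IS LOCALLY CONSTANT ON THE REGULAR SEMISIMPLE SET `{disc ≠ 0}`.  2026-09-04.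
-/
import Summits.HodgeConjecture.HodgeConjecture.Theorems.K2E3CharpolyRootsPerturbation    -- ★ PART 1 (this seat): root bound, normalised strong Hensel, no new roots, persistence, derivative valuations
import Summits.HodgeConjecture.HodgeConjecture.Theorems.F0P3cStCharTSHCDGroupToLie         -- ★ `continuous_discr_charpoly` (`M ↦ disc χ_M` is continuous on `3 × 3` matrices)
import HarnessLib

/-!
# K2_E3 road (h413), §L leaf (LBGL-ge3) at `N = 3`, brick R′ (part 2 of 2) — the rational roots of `χ_X` are locally constant in number on `{disc χ_X ≠ 0}`

Cell `pub/hodgecm-mathlib` (D-0151), Track B (21-frontier RULING «PUSH BOTH» 2026-09-03, director req624), seat K2E3-p03 (g4) (free E3 hand; brick R′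
«HAND WANTED #3» of the Richardson road owner K2E3-p11 (g4)'s (F-E) memo, hand-over 05:24:02Z «R′ UNOWNED → pool»; ALSO serves K2E3-p17 (g6)'s (F-J) census
§1 (vi) «𝔤′ is open AND closed in 𝔤^{rs}»; dealer K2E3-plan (g3)).  `--supports stmt-HodgeConjecture-24833 --as helper`; THEOREMS ONLY (no definition ∕
instance ∕ notation ∕ named fact ∕ `sorry`); never imports `Cruxes/…/Lines`.  COUNT-NEUTRAL: (LBGL-ge3) `sig_K2E3GLnNilpotentFourierRegularGeThree` stays OPEN;
this is the root bookkeeping behind the local constancy clause `∀ X, IsUnit X.charpoly.discr → ∀ᶠ Y in 𝓝 X, W Y = W X` of BOTH slice densities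
(`W_𝔟 = c′·1[χ_X has three roots in F]·‖disc χ_X‖^{-1∕2}` for (LBGL-3J), `W_𝔭 = c·Σ_{χ_X(λ)=0} ‖χ_X′(λ)‖⁻¹` for (LBGL-3E)).

THE RESULT (`F` ANY non-archimedean local field — no restriction on the characteristic or the residue characteristic; `v` the valuation of the valuative
relation; `Polynomial.roots` = the multiset of `F`-RATIONAL roots).  For `X₀ ∈ 𝔤𝔩₃(F)` with `disc χ_{X₀} ≠ 0`:
* **`eventually_card_roots_charpoly_eq`** — `∀ᶠ Y in 𝓝 X₀, card (χ_Y.roots) = card (χ_{X₀}.roots)` (on `{disc ≠ 0}` the count is `0`, `1` or `3`);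
  `eventually_card_roots_charpoly_eq_of_isUnit` (the leaf's `IsUnit` phrasing), `eventually_card_roots_charpoly_eq_three_iff` (the split indicator `1[𝔤′]`);
* **`isOpen_setOf_charpoly_discr_ne_zero_and_card_roots_eq`** — for every `k`, `{X | disc χ_X ≠ 0 ∧ card χ_X.roots = k}` is open (`k = 3`: the split regular
  semisimple set `𝔤′` is open; `k ≠ 3`: its complement inside `𝔤^{rs}` is open);
* rider `eventually_valuation_charpoly_discr_eq` (`v (disc χ_Y) = v (disc χ_{X₀})` near `X₀`, hence `‖disc χ_Y‖_F = ‖disc χ_{X₀}‖_F`);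
* §1 (any field) `card_roots_eq_three_of_three_roots`, `derivative_eval_eq_of_roots_eq` (`f′(μ₁) = (μ₁ − μ₂)(μ₁ − μ₃)` for a split monic cubic);
  §2 `card_roots_eq_one_of_ball` (one small ball carrying all roots and a locally constant `v(f′) = δ ≥ ρ²` ⇒ exactly one rational root).
PROOF («no Krasner, no splitting field», over PART 1).  `disc ≠ 0 ⇒ χ₀` separable, so its rational roots `λ` are simple: `δ_λ := v(χ₀′(λ)) ≠ 0`.  Choose ONE
radius `ρ` below every derivative-constancy radius (PART 1 `exists_eventually_forall_valuation_derivative_eval_eq`), every `δ_λ`, every root separation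
`v(λ − λ′)`, and `≤ 1` (so `ρ² ≤ δ_λ`).  For `Y` near `X₀`: (E1) NO NEW ROOTS — every rational root of `χ_Y` is `ρ`-close to a root of `χ₀` (PART 1
`eventually_forall_isRoot_mem` with `U = ⋃_λ B(λ, ρ)`); (E2) PERSISTENCE — every `λ` has a root of `χ_Y` `ρ`-close to it (PART 1
`eventually_exists_isRoot_valuation_sub_lt`); (E3) `v(χ_Y′) = δ_λ` on `B(λ, ρ)`.  COUNT: `r₀ := card roots χ₀ ∈ {0, 1, 3}` (`≠ 2`, PART 1); `r₀ = 0`: (E1) with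
`U = ∅`; `r₀ = 3`: (E2) gives three roots in three DISJOINT balls (`card_roots_eq_three_of_three_roots`); `r₀ = 1`: `card_roots_eq_one_of_ball` with (E1)–(E3).
[HarishChandra1999AdmissibleDistributions, §7 (the regular semisimple set and its split part); Cassels1986, Ch. 4 §3 Cor. 2 (continuity of roots)]
HONEST LABEL: HC_CM is proved only modulo the 7 printed citations (2 remaining named inputs: hLiu418 = stmt-HodgeConjecture-24832, h413 =
stmt-HodgeConjecture-24833) until rung 0 closes; count-neutral helper.

## References
* [HarishChandra1999AdmissibleDistributions] Harish-Chandra (DeBacker–Sally), *Admissible Invariant Distributions on Reductive p-adic Groups* (1999), §7.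
* [Cassels1986] J. W. S. Cassels, *Local Fields*, LMS Student Texts 3 (1986), Ch. 4 §3 Lemma 3.1, Cor. 1 (strong Hensel), Cor. 2 (continuity of roots).
-/

set_option autoImplicit false
set_option linter.dupNamespace false   -- `Summit.HodgeConjecture.HodgeConjecture.…` (D-0017 nested layout; lakefile exemption for Summits)

noncomputable section

open Filter Topology Set Polynomial
open scoped Matrix
open ValuativeRel

namespace Summit.HodgeConjecture.HodgeConjecture.Cruxes.H413.K2E3CubicRationalRootsLocallyConstant

open Summit.HodgeConjecture.HodgeConjecture.Cruxes.H413.K2E3CharpolyRootsPerturbation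

/-! ## §1  Cubic root combinatorics over a field -/

section FieldCubic

variable {K : Type*} [Field K]

/-- A polynomial of degree `3` with three distinct rational roots has exactly three rational roots (counted with multiplicity). [folklore] -/
theorem card_roots_eq_three_of_three_roots {f : K[X]} (hf0 : f ≠ 0) (hdeg : f.natDegree = 3) {a b c : K}
    (ha : f.IsRoot a) (hb : f.IsRoot b) (hc : f.IsRoot c) (hab : a ≠ b) (hac : a ≠ c) (hbc : b ≠ c) : f.roots.card = 3 := by
  classical
  have hsub : ({a, b, c} : Multiset K) ≤ f.roots := by
    refine (Multiset.le_iff_subset ?_).2 ?_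
    · simp [Multiset.insert_eq_cons, hab, hac, hbc]
    · intro x hx
      simp only [Multiset.insert_eq_cons, Multiset.mem_cons, Multiset.mem_singleton] at hx
      rcases hx with rfl | rfl | rfl
      · exact (mem_roots hf0).2 ha
      · exact (mem_roots hf0).2 hb
      · exact (mem_roots hf0).2 hc
  have h3le : 3 ≤ f.roots.card := by simpa using Multiset.card_le_card hsub
  have hle3 : f.roots.card ≤ 3 := hdeg ▸ card_roots' f
  omega

/-- If a monic cubic splits as `roots f = {μ₁, μ₂, μ₃}` then `f′(μ₁) = (μ₁ − μ₂)(μ₁ − μ₃)`. [folklore] -/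
theorem derivative_eval_eq_of_roots_eq {f : K[X]} (hf : f.Monic) (hdeg : f.natDegree = 3) {μ₁ μ₂ μ₃ : K} (hT : f.roots = {μ₁, μ₂, μ₃}) :
    f.derivative.eval μ₁ = (μ₁ - μ₂) * (μ₁ - μ₃) := by
  classical
  have hcard : f.roots.card = f.natDegree := by rw [hT, hdeg]; simp
  have hprod := prod_multiset_X_sub_C_of_monic_of_roots_card_eq hf hcard
  have hmem : μ₁ ∈ f.roots := by rw [hT]; simp
  conv_lhs => rw [← hprod]
  rw [eval_multiset_prod_X_sub_C_derivative hmem, hT]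
  simp [Multiset.insert_eq_cons]

end FieldCubic

/-! ## §2  The count near `X₀` for `3 × 3` matrices over a non-archimedean local field -/

section Cubic

variable {F : Type*} [Field F] [ValuativeRel F] [TopologicalSpace F] [IsNonarchimedeanLocalField F]

omit [TopologicalSpace F] [IsNonarchimedeanLocalField F] in
/-- **One ball, one root**: if every rational root of the monic cubic `f` is `ρ`-close to `x`, `f` has a rational root, and `v(f′(y)) = δ ≥ ρ·ρ` for every `y`
`ρ`-close to `x`, then `f` has exactly ONE rational root (three roots `μ₁, μ₂, μ₃` in the ball would give `v(f′(μ₁)) = v((μ₁ − μ₂)(μ₁ − μ₃)) < ρ·ρ`).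
[cite: Cassels1986, Ch. 4 §3 Cor. 2] -/
theorem card_roots_eq_one_of_ball {f : F[X]} (hf : f.Monic) (hdeg : f.natDegree = 3) {x : F} {ρ δ : ValueGroupWithZero F} (hρ : 0 < ρ)
    (hall : ∀ μ ∈ f.roots, valuation F (μ - x) < ρ) (hex : ∃ μ, f.IsRoot μ)
    (hder : ∀ y, valuation F (y - x) < ρ → valuation F (f.derivative.eval y) = δ) (hρδ : ρ * ρ ≤ δ) :
    f.roots.card = 1 := by
  classical
  have hf0 : f ≠ 0 := hf.ne_zero
  obtain ⟨μ, hμ⟩ := hex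
  have h1 : 1 ≤ f.roots.card := Multiset.card_pos_iff_exists_mem.2 ⟨μ, (mem_roots hf0).2 hμ⟩
  have hle3 : f.roots.card ≤ 3 := hdeg ▸ card_roots' f
  have h2 : f.roots.card ≠ 2 := card_roots_ne_two_of_natDegree_eq_three hdeg
  have h3 : f.roots.card ≠ 3 := by
    intro h3
    obtain ⟨μ₁, μ₂, μ₃, hT⟩ := Multiset.card_eq_three.1 h3
    have hμ₁ : μ₁ ∈ f.roots := by rw [hT]; simp
    have hμ₂ : μ₂ ∈ f.roots := by rw [hT]; simp
    have hμ₃ : μ₃ ∈ f.roots := by rw [hT]; simp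
    have hv : valuation F (f.derivative.eval μ₁) < ρ * ρ := by
      rw [derivative_eval_eq_of_roots_eq hf hdeg hT, map_mul]
      exact mul_lt_mul_of_le_of_lt_of_nonneg_of_pos (valuation_sub_lt_of_lt_of_lt (hall μ₁ hμ₁) (hall μ₂ hμ₂)).le
        (valuation_sub_lt_of_lt_of_lt (hall μ₁ hμ₁) (hall μ₃ hμ₃)) zero_le hρ
    have heq : valuation F (f.derivative.eval μ₁) = δ := hder μ₁ (hall μ₁ hμ₁)
    exact (lt_irrefl _) ((hv.trans_le hρδ).trans_le heq.ge)
  omega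

/-- **R′ (the head).**  For `X₀ ∈ 𝔤𝔩₃(F)` with `disc χ_{X₀} ≠ 0`, the number of `F`-rational roots of `χ_Y` equals that of `χ_{X₀}` for all `Y` near `X₀`
(`F` any non-archimedean local field; `Polynomial.roots` = the multiset of rational roots).
[cite: Cassels1986, Ch. 4 §3 Cor. 2] [cite: HarishChandra1999AdmissibleDistributions, §7] -/
theorem eventually_card_roots_charpoly_eq (X₀ : Matrix (Fin 3) (Fin 3) F) (hD : X₀.charpoly.discr ≠ 0) :
    ∀ᶠ Y in 𝓝 X₀, Y.charpoly.roots.card = X₀.charpoly.roots.card := by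
  classical
  -- data of `χ₀`
  have hmon : X₀.charpoly.Monic := Matrix.charpoly_monic X₀
  have hdeg : X₀.charpoly.natDegree = 3 := by rw [Matrix.charpoly_natDegree_eq_dim, Fintype.card_fin]
  have hχ0 : X₀.charpoly ≠ 0 := hmon.ne_zero
  have hsep : X₀.charpoly.Separable := separable_of_discr_ne_zero hmon (by omega) hD
  have hdegY : ∀ Y : Matrix (Fin 3) (Fin 3) F, Y.charpoly.natDegree = 3 := fun Y => by
    rw [Matrix.charpoly_natDegree_eq_dim, Fintype.card_fin]
  have hY0 : ∀ Y : Matrix (Fin 3) (Fin 3) F, Y.charpoly ≠ 0 := fun Y => (Matrix.charpoly_monic Y).ne_zero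
  have hmemS : ∀ x, x ∈ X₀.charpoly.roots.toFinset ↔ X₀.charpoly.IsRoot x := fun x => by rw [Multiset.mem_toFinset, mem_roots hχ0]
  -- simple roots
  have hδ : ∀ x ∈ X₀.charpoly.roots.toFinset, X₀.charpoly.derivative.eval x ≠ 0 := by
    intro x hx
    have h := hsep.eval₂_derivative_ne_zero (RingHom.id F) (x := x) ((hmemS x).1 hx)
    simpa using h
  -- per-root radii of derivative constancy
  have hrad : ∀ x ∈ X₀.charpoly.roots.toFinset, ∃ ρ : (ValueGroupWithZero F)ˣ, ∀ᶠ Y in 𝓝 X₀, ∀ y, valuation F (y - x) < ρ →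
      valuation F (Y.charpoly.derivative.eval y) = valuation F (X₀.charpoly.derivative.eval x) :=
    fun x hx => exists_eventually_forall_valuation_derivative_eval_eq X₀ (hδ x hx)
  choose! ρd hρd using hrad
  -- ONE radius `ρ`: below every `ρd x`, every `δ_x`, every root separation `v(x − x′)`, and `≤ 1`
  obtain ⟨ρA, hρA⟩ := exists_units_le_of_finset X₀.charpoly.roots.toFinset ρd
  obtain ⟨ρB, hρB⟩ := exists_units_le_of_finset X₀.charpoly.roots.toFinset (fun x =>
    if hx : X₀.charpoly.derivative.eval x ≠ 0 then Units.mk0 (valuation F (X₀.charpoly.derivative.eval x)) ((Valuation.ne_zero_iff _).2 hx) else 1)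
  obtain ⟨ρC, hρC⟩ := exists_units_le_of_finset (X₀.charpoly.roots.toFinset ×ˢ X₀.charpoly.roots.toFinset) (fun q =>
    if hq : q.1 ≠ q.2 then Units.mk0 (valuation F (q.1 - q.2)) ((Valuation.ne_zero_iff _).2 (sub_ne_zero.2 hq)) else 1)
  obtain ⟨ρ, hρA', hρB', hρC', hρ1⟩ : ∃ ρ : (ValueGroupWithZero F)ˣ, ρ ≤ ρA ∧ ρ ≤ ρB ∧ ρ ≤ ρC ∧ ρ ≤ 1 :=
    ⟨min (min ρA ρB) (min ρC 1), (min_le_left _ _).trans (min_le_left _ _), (min_le_left _ _).trans (min_le_right _ _),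
      (min_le_right _ _).trans (min_le_left _ _), (min_le_right _ _).trans (min_le_right _ _)⟩
  have hρ1' : (ρ : ValueGroupWithZero F) ≤ 1 := by
    have h := Units.val_le_val.2 hρ1
    rwa [Units.val_one] at h
  have hρδ : ∀ x ∈ X₀.charpoly.roots.toFinset, (ρ : ValueGroupWithZero F) * ρ ≤ valuation F (X₀.charpoly.derivative.eval x) := by
    intro x hx
    have hB := hρB x hx
    rw [dif_pos (hδ x hx)] at hB
    have h : (ρ : ValueGroupWithZero F) ≤ valuation F (X₀.charpoly.derivative.eval x) := Units.val_le_val.2 (hρB'.trans hB)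
    calc (ρ : ValueGroupWithZero F) * ρ ≤ ρ * 1 := mul_le_mul le_rfl hρ1' zero_le zero_le
      _ ≤ valuation F (X₀.charpoly.derivative.eval x) := by rw [mul_one]; exact h
  have hρsep : ∀ x ∈ X₀.charpoly.roots.toFinset, ∀ x' ∈ X₀.charpoly.roots.toFinset, x ≠ x' →
      (ρ : ValueGroupWithZero F) ≤ valuation F (x - x') := by
    intro x hx x' hx' hne
    have hC := hρC (x, x') (Finset.mk_mem_product hx hx')
    rw [dif_pos (show (x, x').1 ≠ (x, x').2 from hne)] at hC
    exact Units.val_le_val.2 (hρC'.trans hC)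
  -- the open set `U = ⋃_λ B(λ, ρ)`
  have hUo : IsOpen (⋃ x ∈ X₀.charpoly.roots.toFinset, {y : F | valuation F (y - x) < ρ}) :=
    isOpen_biUnion fun x _ => isOpen_setOf_valuation_sub_lt x ρ
  have hUroots : ∀ x, X₀.charpoly.IsRoot x → x ∈ ⋃ x' ∈ X₀.charpoly.roots.toFinset, {y : F | valuation F (y - x') < ρ} := by
    intro x hx
    refine Set.mem_biUnion ((hmemS x).2 hx) ?_
    show valuation F (x - x) < ρ
    rw [sub_self, map_zero]
    exact ρ.zero_lt
  -- (E1) no new roots, (E2) persistence, (E3) derivative constancy — for `Y` near `X₀`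
  have E1 : ∀ᶠ Y in 𝓝 X₀, ∀ μ, Y.charpoly.IsRoot μ → ∃ x ∈ X₀.charpoly.roots.toFinset, valuation F (μ - x) < ρ := by
    filter_upwards [eventually_forall_isRoot_mem X₀ hUo hUroots] with Y hY μ hμ
    have h := hY μ hμ
    simp only [Set.mem_iUnion, Set.mem_setOf_eq, exists_prop] at h
    exact h
  have E2 : ∀ᶠ Y in 𝓝 X₀, ∀ x ∈ X₀.charpoly.roots.toFinset, ∃ μ, Y.charpoly.IsRoot μ ∧ valuation F (μ - x) < ρ :=
    (Filter.eventually_all_finset _).2 fun x hx => eventually_exists_isRoot_valuation_sub_lt X₀ ((hmemS x).1 hx) (hδ x hx) ρ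
  have E3 : ∀ᶠ Y in 𝓝 X₀, ∀ x ∈ X₀.charpoly.roots.toFinset, ∀ y, valuation F (y - x) < ρ →
      valuation F (Y.charpoly.derivative.eval y) = valuation F (X₀.charpoly.derivative.eval x) := by
    refine (Filter.eventually_all_finset _).2 fun x hx => ?_
    filter_upwards [hρd x hx] with Y hY y hy
    exact hY y (lt_of_lt_of_le hy (Units.val_le_val.2 (hρA'.trans (hρA x hx))))
  filter_upwards [E1, E2, E3] with Y h1 h2 h3
  -- THE COUNT: `r₀ ∈ {0, 1, 3}`
  have hcardS : X₀.charpoly.roots.card ≤ 3 := by have h := card_roots' X₀.charpoly; rwa [hdeg] at h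
  have hS2 : X₀.charpoly.roots.card ≠ 2 := card_roots_ne_two_of_natDegree_eq_three hdeg
  rcases Nat.lt_or_ge X₀.charpoly.roots.card 1 with h0 | h1'
  · -- `r₀ = 0`: no roots anywhere
    have hS0 : X₀.charpoly.roots = 0 := Multiset.card_eq_zero.1 (by omega)
    have hT0 : Y.charpoly.roots = 0 := by
      refine Multiset.eq_zero_of_forall_notMem fun μ hμ => ?_
      obtain ⟨x, hx, -⟩ := h1 μ ((mem_roots (hY0 Y)).1 hμ)
      rw [hS0] at hx
      exact Multiset.notMem_zero x (Multiset.mem_toFinset.1 hx)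
    rw [hT0, hS0]
  rcases Nat.lt_or_ge X₀.charpoly.roots.card 2 with h1'' | h2'
  · -- `r₀ = 1`: one ball, one root
    have hS1 : X₀.charpoly.roots.card = 1 := by omega
    obtain ⟨x, hSx⟩ := Multiset.card_eq_one.1 hS1
    have hxS : x ∈ X₀.charpoly.roots.toFinset := by rw [Multiset.mem_toFinset, hSx]; exact Multiset.mem_singleton_self x
    have honly : ∀ x' ∈ X₀.charpoly.roots.toFinset, x' = x := fun x' hx' => by
      rw [Multiset.mem_toFinset, hSx, Multiset.mem_singleton] at hx'
      exact hx'
    have hall : ∀ μ ∈ Y.charpoly.roots, valuation F (μ - x) < ρ := by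
      intro μ hμ
      obtain ⟨x', hx', hlt⟩ := h1 μ ((mem_roots (hY0 Y)).1 hμ)
      rwa [honly x' hx'] at hlt
    obtain ⟨μ, hμ, -⟩ := h2 x hxS
    rw [hS1]
    exact card_roots_eq_one_of_ball (Matrix.charpoly_monic Y) (hdegY Y) ρ.zero_lt hall ⟨μ, hμ⟩ (h3 x hxS) (hρδ x hxS)
  · -- `r₀ = 3`: three disjoint balls, a root in each
    have hS3 : X₀.charpoly.roots.card = 3 := by omega
    obtain ⟨x₁, x₂, x₃, hS123⟩ := Multiset.card_eq_three.1 hS3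
    have hnd : x₁ ≠ x₂ ∧ x₁ ≠ x₃ ∧ x₂ ≠ x₃ := by
      have h := nodup_roots hsep
      rw [hS123] at h
      simp only [Multiset.insert_eq_cons, Multiset.nodup_cons, Multiset.mem_cons, Multiset.mem_singleton, Multiset.nodup_singleton,
        not_or, and_true] at h
      exact ⟨h.1.1, h.1.2, h.2⟩
    have hx₁ : x₁ ∈ X₀.charpoly.roots.toFinset := by rw [Multiset.mem_toFinset, hS123]; simp
    have hx₂ : x₂ ∈ X₀.charpoly.roots.toFinset := by rw [Multiset.mem_toFinset, hS123]; simp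
    have hx₃ : x₃ ∈ X₀.charpoly.roots.toFinset := by rw [Multiset.mem_toFinset, hS123]; simp
    obtain ⟨μ₁, hμ₁, hμ₁x⟩ := h2 x₁ hx₁
    obtain ⟨μ₂, hμ₂, hμ₂x⟩ := h2 x₂ hx₂
    obtain ⟨μ₃, hμ₃, hμ₃x⟩ := h2 x₃ hx₃
    -- the three new roots are distinct (the balls are disjoint)
    have hsep' : ∀ {μ μ' y y' : F}, y ∈ X₀.charpoly.roots.toFinset → y' ∈ X₀.charpoly.roots.toFinset → y ≠ y' →
        valuation F (μ - y) < ρ → valuation F (μ' - y') < ρ → μ ≠ μ' := by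
      intro μ μ' y y' hy hy' hne hμy hμ'y' heq
      subst heq
      have hlt : valuation F (y - y') < ρ :=
        valuation_sub_lt_of_lt_of_lt (by rw [Valuation.map_sub_swap]; exact hμy) (by rw [Valuation.map_sub_swap]; exact hμ'y')
      exact (lt_irrefl _) (hlt.trans_le (hρsep y hy y' hy' hne))
    rw [hS3]
    exact card_roots_eq_three_of_three_roots (hY0 Y) (hdegY Y) hμ₁ hμ₂ hμ₃ (hsep' hx₁ hx₂ hnd.1 hμ₁x hμ₂x)
      (hsep' hx₁ hx₃ hnd.2.1 hμ₁x hμ₃x) (hsep' hx₂ hx₃ hnd.2.2 hμ₂x hμ₃x)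

/-- **𝔤′ and its complement in 𝔤^{rs} are open**: for every `k`, `{X ∈ 𝔤𝔩₃(F) | disc χ_X ≠ 0 ∧ #(rational roots of χ_X) = k}` is open (`k = 3`: the split
regular semisimple set; ★ `continuous_discr_charpoly`). [cite: HarishChandra1999AdmissibleDistributions, §7] -/
theorem isOpen_setOf_charpoly_discr_ne_zero_and_card_roots_eq (k : ℕ) :
    IsOpen {X : Matrix (Fin 3) (Fin 3) F | X.charpoly.discr ≠ 0 ∧ X.charpoly.roots.card = k} := by
  haveI : T2Space F := (Literature.NumberTheory.GaloisRepresentations.IsNonarchimedeanLocalField.isLocalField F).toT2Space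
  rw [isOpen_iff_mem_nhds]
  rintro X ⟨hD, hk⟩
  have h1 : ∀ᶠ Y in 𝓝 X, Y.charpoly.discr ≠ 0 :=
    (F0P3cStCharTSHCDGroupToLie.continuous_discr_charpoly (K := F)).continuousAt.eventually_ne hD
  filter_upwards [h1, eventually_card_roots_charpoly_eq X hD] with Y hY hY'
  exact ⟨hY, hY'.trans hk⟩

/-- `IsUnit`-phrased variant (the leaf's hypothesis `IsUnit X.charpoly.discr`): near `X₀` the rational root count of `χ_Y` is that of `χ_{X₀}`.
[cite: HarishChandra1999AdmissibleDistributions, §7] -/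
theorem eventually_card_roots_charpoly_eq_of_isUnit (X₀ : Matrix (Fin 3) (Fin 3) F) (hD : IsUnit X₀.charpoly.discr) :
    ∀ᶠ Y in 𝓝 X₀, Y.charpoly.roots.card = X₀.charpoly.roots.card :=
  eventually_card_roots_charpoly_eq X₀ hD.ne_zero

/-- **The split regular semisimple indicator is locally constant on `{disc ≠ 0}`**: near `X₀` (`disc χ_{X₀} ≠ 0`), `χ_Y` has three rational roots iff `χ_{X₀}`
does. [cite: HarishChandra1999AdmissibleDistributions, §7] -/
theorem eventually_card_roots_charpoly_eq_three_iff (X₀ : Matrix (Fin 3) (Fin 3) F) (hD : X₀.charpoly.discr ≠ 0) :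
    ∀ᶠ Y in 𝓝 X₀, (Y.charpoly.roots.card = 3 ↔ X₀.charpoly.roots.card = 3) := by
  filter_upwards [eventually_card_roots_charpoly_eq X₀ hD] with Y hY
  rw [hY]

/-- Rider: **`v(disc χ_Y) = v(disc χ_{X₀})` near `X₀`** when `disc χ_{X₀} ≠ 0` (★ `continuous_discr_charpoly` + `Valuation.locally_const`); in particular
`‖disc χ_Y‖_F = ‖disc χ_{X₀}‖_F` for the normalised absolute value, which is a function of the valuation. [folklore] -/
theorem eventually_valuation_charpoly_discr_eq (X₀ : Matrix (Fin 3) (Fin 3) F) (hD : X₀.charpoly.discr ≠ 0) :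
    ∀ᶠ Y in 𝓝 X₀, valuation F Y.charpoly.discr = valuation F X₀.charpoly.discr := by
  have hne : valuation F X₀.charpoly.discr ≠ 0 := (Valuation.ne_zero_iff _).2 hD
  filter_upwards [(F0P3cStCharTSHCDGroupToLie.continuous_discr_charpoly (K := F)).continuousAt.preimage_mem_nhds
    ((valuation F).locally_const hne)] with Y hY
  exact hY

end Cubic

/-! ## ED. 2 (J0, K2E3-p17 (g6) 05:32:09Z ask for brick H) — a `3 × 3` matrix whose characteristic polynomial has three rational roots and non-zero
discriminant is diagonalisable over the ground field (append-only; every ED. 1 declaration above is byte-identical) -/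

section Diagonalisable

variable {K : Type*} [Field K]

/-- **(J0) Split regular semisimple ⇒ diagonalisable over `K`.**  If `χ_X` (`X ∈ 𝔤𝔩₃(K)`, `K` any field) has three rational roots and non-zero discriminant,
then `X = g · diagonal d · g⁻¹` for some `g ∈ GL₃(K)` and an injective `d : Fin 3 → K` (the three distinct rational eigenvalues; eigenvectors for distinct
eigenvalues are linearly independent, Mathlib `Module.End.eigenvectors_linearIndependent'`, and form the columns of `g`).
[cite: HarishChandra1999AdmissibleDistributions, §7] -/
theorem exists_conj_diagonal_of_card_roots_eq_three (X : Matrix (Fin 3) (Fin 3) K) (h3 : X.charpoly.roots.card = 3) (hD : X.charpoly.discr ≠ 0) :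
    ∃ (g : GL (Fin 3) K) (d : Fin 3 → K), Function.Injective d ∧
      X = (g : Matrix (Fin 3) (Fin 3) K) * Matrix.diagonal d * ((g⁻¹ : GL (Fin 3) K) : Matrix (Fin 3) (Fin 3) K) := by
  classical
  have hmon : X.charpoly.Monic := Matrix.charpoly_monic X
  have hdeg : X.charpoly.natDegree = 3 := by rw [Matrix.charpoly_natDegree_eq_dim, Fintype.card_fin]
  have hχ0 : X.charpoly ≠ 0 := hmon.ne_zero
  have hsep : X.charpoly.Separable := separable_of_discr_ne_zero hmon (by omega) hD
  obtain ⟨x₁, x₂, x₃, hT⟩ := Multiset.card_eq_three.1 h3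
  have hne : x₁ ≠ x₂ ∧ x₁ ≠ x₃ ∧ x₂ ≠ x₃ := by
    have h := nodup_roots hsep
    rw [hT] at h
    simp only [Multiset.insert_eq_cons, Multiset.nodup_cons, Multiset.mem_cons, Multiset.mem_singleton, Multiset.nodup_singleton,
      not_or, and_true] at h
    exact ⟨h.1.1, h.1.2, h.2⟩
  -- the three eigenvalues
  set d : Fin 3 → K := ![x₁, x₂, x₃] with hd
  have hdinj : Function.Injective d := by
    intro i j hij
    fin_cases i <;> fin_cases j <;> simp [hd] at hij ⊢ <;>
      first
      | exact absurd hij hne.1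
      | exact absurd hij.symm hne.1
      | exact absurd hij hne.2.1
      | exact absurd hij.symm hne.2.1
      | exact absurd hij hne.2.2
      | exact absurd hij.symm hne.2.2
  have hroot : ∀ i, X.charpoly.IsRoot (d i) := by
    intro i
    rw [← mem_roots hχ0, hT]
    fin_cases i <;> simp [hd]
  -- eigenvectors
  have heig : ∀ i, ∃ v : Fin 3 → K, v ≠ 0 ∧ X *ᵥ v = d i • v := by
    intro i
    have hdet : (Matrix.scalar (Fin 3) (d i) - X).det = 0 := by rw [← Matrix.eval_charpoly]; exact hroot i
    obtain ⟨v, hv0, hv⟩ := Matrix.exists_mulVec_eq_zero_iff.2 hdet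
    refine ⟨v, hv0, ?_⟩
    rw [Matrix.sub_mulVec, sub_eq_zero] at hv
    rw [← hv]
    ext j
    simp [Matrix.scalar_apply, Matrix.mulVec_diagonal]
  choose v hv0 hv using heig
  have hli : LinearIndependent K v := by
    refine Module.End.eigenvectors_linearIndependent' (Matrix.toLin' X) d hdinj v fun i => ?_
    exact ⟨Module.End.mem_eigenspace_iff.2 (by rw [Matrix.toLin'_apply, hv i]), hv0 i⟩
  -- the matrix of eigenvectors (columns `v j`)
  set P : Matrix (Fin 3) (Fin 3) K := (Matrix.of v)ᵀ with hP
  have hPu : IsUnit P := by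
    rw [← Matrix.linearIndependent_cols_iff_isUnit, hP, Matrix.col_transpose]
    exact hli
  have hXP : X * P = P * Matrix.diagonal d := by
    ext i j
    have hij : (X *ᵥ v j) i = d j * v j i := by rw [hv j]; simp
    calc (X * P) i j = (X *ᵥ v j) i := by simp [hP, Matrix.mul_apply, Matrix.mulVec, dotProduct]
      _ = d j * v j i := hij
      _ = (P * Matrix.diagonal d) i j := by rw [Matrix.mul_diagonal]; simp [hP, mul_comm]
  refine ⟨hPu.unit, d, hdinj, ?_⟩
  have hPinv : P * ((hPu.unit⁻¹ : GL (Fin 3) K) : Matrix (Fin 3) (Fin 3) K) = 1 := by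
    have h := hPu.unit.mul_inv
    rwa [IsUnit.unit_spec] at h
  calc X = X * (P * ((hPu.unit⁻¹ : GL (Fin 3) K) : Matrix (Fin 3) (Fin 3) K)) := by rw [hPinv, mul_one]
    _ = X * P * ((hPu.unit⁻¹ : GL (Fin 3) K) : Matrix (Fin 3) (Fin 3) K) := by rw [mul_assoc]
    _ = P * Matrix.diagonal d * ((hPu.unit⁻¹ : GL (Fin 3) K) : Matrix (Fin 3) (Fin 3) K) := by rw [hXP]
    _ = (hPu.unit : Matrix (Fin 3) (Fin 3) K) * Matrix.diagonal d * ((hPu.unit⁻¹ : GL (Fin 3) K) : Matrix (Fin 3) (Fin 3) K) := by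
        rw [IsUnit.unit_spec]

end Diagonalisable

end Summit.HodgeConjecture.HodgeConjecture.Cruxes.H413.K2E3CubicRationalRootsLocallyConstant

end
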